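import Summits.Ventures.PercRepro.S1ChainSkewFilter

/-!
# PercRepro — THE HULL OF A SET IN A SKEW UNION AND THE MINIMAL SPANNING SETS OF AN OUTSIDE POINT (p2, gen 24; SUBCLAIM-S1 §6.9 (vii) step 4, preliminaries)

For `B ⊆ U = ⋃𝒯` (a skew union of triangles) the HULL `B ∪ ⋃{T ∈ 𝒯 : |B ∩ T| ≥ 2}` is the trace `cl(B) ∩ U` of its
closure (the closure formula), a closed trace with `cl(hull B) = cl(B)`. For a point `z ∈ E ∖ U` in the closure of `U`
with principal closed trace `F_z` (S1ChainSkewFilter): `z ∈ cl(B) ⇔ F_z ⊆ hull B`. A circuit `{z} ∪ B` (`B ⊆ U`)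
is therefore a MINIMAL `B` with `F_z ⊆ hull B`, and minimality reads coordinatewise: `B` meets a triangle only if
`F_z` does; on a triangle `T ⊆ F_z` it has `≥ 2` points; on a triangle with `F_z ∩ T = {a}` it is `{a}` or the other
two points of `T`. These are the facts behind the one-point counts `s₄(z) ≤ 3`, `s₅(z) ≤ 9` of the joint cap of row 10.

* the hull `B ∪ ⋃{T : |B ∩ T| ≥ 2}` (spelled out, no new definition): `mem_skewHull_iff`, `subset_skewHull`, `skewHull_subset`, `mem_closure_iff_mem_skewHull`, `skewHull_closedTrace`, `closure_skewHull_eq`;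
* **`mem_closure_iff_principal_subset_skewHull`** — `z ∈ cl B ⇔ F_z ⊆ hull B`;
* `notMem_closure_of_ssubset_of_isCircuit` — minimality of a circuit's trace; `mem_skewHull_diff_iff` — removing a point of `T` leaves the hull on the other triangles;
* **`shape_of_isCircuit_of_principal`** — the coordinatewise shape of the trace of a circuit through `z`.
Axioms: standard.
-/

open scoped Matroid

namespace PercRepro

namespace S1

open Set

variable {α : Type}

/-- Membership in the hull: a point of `B`, or a point of a triangle meeting `B` in `≥ 2` points. -/
theorem mem_skewHull_iff (𝒯 : Finset (Set α)) (B : Set α) (x : α) :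
    x ∈ (B ∪ ⋃ T ∈ 𝒯.filter (fun T => 2 ≤ (B ∩ T).ncard), T) ↔ x ∈ B ∨ ∃ T ∈ 𝒯, x ∈ T ∧ 2 ≤ (B ∩ T).ncard := by
  simp only [Set.mem_union, Set.mem_iUnion, Finset.mem_filter, exists_prop]
  constructor
  · rintro (h | ⟨T, ⟨hT, h2⟩, hx⟩)
    · exact Or.inl h
    · exact Or.inr ⟨T, hT, hx, h2⟩
  · rintro (h | ⟨T, hT, hx, h2⟩)
    · exact Or.inl h
    · exact Or.inr ⟨T, ⟨hT, h2⟩, hx⟩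

/-- `B` lies in its hull. -/
theorem subset_skewHull (𝒯 : Finset (Set α)) (B : Set α) : B ⊆ (B ∪ ⋃ T ∈ 𝒯.filter (fun T => 2 ≤ (B ∩ T).ncard), T) := fun _ hx => Or.inl hx

/-- The hull of a subset of `U` lies in `U`. -/
theorem skewHull_subset (𝒯 : Finset (Set α)) {B : Set α} (hB : B ⊆ ⋃ C ∈ 𝒯, C) :
    (B ∪ ⋃ T ∈ 𝒯.filter (fun T => 2 ≤ (B ∩ T).ncard), T) ⊆ ⋃ C ∈ 𝒯, C := by
  intro x hx
  rw [mem_skewHull_iff] at hx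
  rcases hx with h | ⟨T, hT, hx, -⟩
  · exact hB h
  · exact Set.mem_iUnion₂.2 ⟨T, hT, hx⟩

/-- **THE HULL IS THE TRACE OF THE CLOSURE**: `x ∈ U` lies in `cl B` iff it lies in the hull of `B`. -/
theorem mem_closure_iff_mem_skewHull (M : Matroid α) [M.Finite] (𝒯 : Finset (Set α))
    (h𝒯 : ∀ C ∈ 𝒯, M.IsCircuit C ∧ C.ncard = 3) (hskew : M.eRk (⋃ C ∈ 𝒯, C) = 2 * 𝒯.card)
    {B : Set α} (hB : B ⊆ ⋃ C ∈ 𝒯, C) {x : α} (hx : x ∈ ⋃ C ∈ 𝒯, C) :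
    x ∈ M.closure B ↔ x ∈ (B ∪ ⋃ T ∈ 𝒯.filter (fun T => 2 ≤ (B ∩ T).ncard), T) := by
  rw [mem_closure_iff_of_skew_union M 𝒯 h𝒯 hskew hB hx, mem_skewHull_iff]

/-- The hull is a closed trace. -/
theorem skewHull_closedTrace (M : Matroid α) [M.Finite] (𝒯 : Finset (Set α))
    (h𝒯 : ∀ C ∈ 𝒯, M.IsCircuit C ∧ C.ncard = 3) (hskew : M.eRk (⋃ C ∈ 𝒯, C) = 2 * 𝒯.card)
    (B : Set α) :
    ∀ T ∈ 𝒯, ((B ∪ ⋃ T ∈ 𝒯.filter (fun T => 2 ≤ (B ∩ T).ncard), T) ∩ T).ncard ≤ 1 ∨ T ⊆ (B ∪ ⋃ T ∈ 𝒯.filter (fun T => 2 ≤ (B ∩ T).ncard), T) := by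
  intro T hT
  by_cases h2 : 2 ≤ (B ∩ T).ncard
  · right
    intro x hx
    rw [mem_skewHull_iff]
    exact Or.inr ⟨T, hT, hx, h2⟩
  · left
    push Not at h2
    -- the trace of the hull on `T` is the trace of `B`: a point of `T` in another triangle's hull is impossible
    have hsub : (B ∪ ⋃ T ∈ 𝒯.filter (fun T => 2 ≤ (B ∩ T).ncard), T) ∩ T ⊆ B ∩ T := by
      intro x hx
      obtain ⟨hxH, hxT⟩ := hx
      rw [mem_skewHull_iff] at hxH
      rcases hxH with h | ⟨T', hT', hxT', h2'⟩
      · exact ⟨h, hxT⟩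
      · by_cases hTT : T' = T
        · subst hTT; omega
        · have hd := disjoint_of_skew_union M 𝒯 h𝒯 hskew hT' hT hTT
          exact absurd hxT (Set.disjoint_left.1 hd hxT')
    have hTfin : T.Finite := M.ground_finite.subset (h𝒯 T hT).1.subset_ground
    exact (Set.ncard_le_ncard hsub (hTfin.subset Set.inter_subset_right)).trans (by omega)

/-- The closure of the hull is the closure of `B`. -/
theorem closure_skewHull_eq (M : Matroid α) [M.Finite] (𝒯 : Finset (Set α))
    (h𝒯 : ∀ C ∈ 𝒯, M.IsCircuit C ∧ C.ncard = 3) (hskew : M.eRk (⋃ C ∈ 𝒯, C) = 2 * 𝒯.card)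
    {B : Set α} (hB : B ⊆ ⋃ C ∈ 𝒯, C) : M.closure ((B ∪ ⋃ T ∈ 𝒯.filter (fun T => 2 ≤ (B ∩ T).ncard), T)) = M.closure B := by
  have hUE := biUnion_subset_ground M 𝒯 h𝒯
  apply Set.Subset.antisymm
  · apply M.closure_subset_closure_of_subset_closure
    intro x hx
    have hxU : x ∈ ⋃ C ∈ 𝒯, C := skewHull_subset 𝒯 hB hx
    exact (mem_closure_iff_mem_skewHull M 𝒯 h𝒯 hskew hB hxU).2 hx
  · exact M.closure_subset_closure (subset_skewHull 𝒯 B)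

/-- **`z ∈ cl B ⇔ F_z ⊆ hull B`** for the principal closed trace `F_z` of an outside point `z`. -/
theorem mem_closure_iff_principal_subset_skewHull (M : Matroid α) [M.Finite] (𝒯 : Finset (Set α))
    (h𝒯 : ∀ C ∈ 𝒯, M.IsCircuit C ∧ C.ncard = 3) (hskew : M.eRk (⋃ C ∈ 𝒯, C) = 2 * 𝒯.card)
    {z : α} {F : Set α} (hzF : z ∈ M.closure F)
    (hFmin : ∀ A ⊆ ⋃ C ∈ 𝒯, C, (∀ T ∈ 𝒯, (A ∩ T).ncard ≤ 1 ∨ T ⊆ A) → z ∈ M.closure A → F ⊆ A)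
    {B : Set α} (hB : B ⊆ ⋃ C ∈ 𝒯, C) : z ∈ M.closure B ↔ F ⊆ (B ∪ ⋃ T ∈ 𝒯.filter (fun T => 2 ≤ (B ∩ T).ncard), T) := by
  constructor
  · intro hzB
    refine hFmin ((B ∪ ⋃ T ∈ 𝒯.filter (fun T => 2 ≤ (B ∩ T).ncard), T)) (skewHull_subset 𝒯 hB) (skewHull_closedTrace M 𝒯 h𝒯 hskew B) ?_
    rw [closure_skewHull_eq M 𝒯 h𝒯 hskew hB]
    exact hzB
  · intro hFH
    have h1 : z ∈ M.closure ((B ∪ ⋃ T ∈ 𝒯.filter (fun T => 2 ≤ (B ∩ T).ncard), T)) := M.closure_subset_closure hFH hzF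
    rwa [closure_skewHull_eq M 𝒯 h𝒯 hskew hB] at h1

/-- In a circuit `{z} ∪ B` with `z ∉ B`, no proper subset of `B` spans `z`. -/
theorem notMem_closure_of_ssubset_of_isCircuit (M : Matroid α) {z : α} {B B' : Set α}
    (hC : M.IsCircuit (insert z B)) (hzB : z ∉ B) (hB' : B' ⊂ B) : z ∉ M.closure B' := by
  intro hzB'
  have hI : M.Indep (insert z B') := hC.ssubset_indep
    ⟨Set.insert_subset_insert hB'.1, fun h => by
      obtain ⟨x, hxB, hxB'⟩ := Set.exists_of_ssubset hB'
      have := h (Set.mem_insert_of_mem z hxB)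
      rw [Set.mem_insert_iff] at this
      rcases this with rfl | h'
      · exact hzB hxB
      · exact hxB' h'⟩
  have hB'E : B' ⊆ M.E := (Set.subset_insert z B').trans hI.subset_ground
  have hzE : z ∈ M.E := hI.subset_ground (Set.mem_insert z B')
  have hzB'' : z ∉ B' := fun h => hzB (hB'.1 h)
  have hIB' : M.Indep B' := hI.subset (Set.subset_insert z B')
  exact absurd hzB' ((hIB'.notMem_closure_iff hzE).mpr ⟨hI, hzB''⟩)

/-- Removing a point of the triangle `T` from `B` does not change the hull on the other triangles. -/
theorem mem_skewHull_diff_iff (M : Matroid α) [M.Finite] (𝒯 : Finset (Set α))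
    (h𝒯 : ∀ C ∈ 𝒯, M.IsCircuit C ∧ C.ncard = 3) (hskew : M.eRk (⋃ C ∈ 𝒯, C) = 2 * 𝒯.card)
    {B : Set α} {T T' : Set α} (hT : T ∈ 𝒯) (hT' : T' ∈ 𝒯) (hne : T' ≠ T) {x : α} (hxT : x ∈ T)
    {y : α} (hyT' : y ∈ T') : y ∈ (B \ {x} ∪ ⋃ T ∈ 𝒯.filter (fun T => 2 ≤ (B \ {x} ∩ T).ncard), T) ↔ y ∈ (B ∪ ⋃ T ∈ 𝒯.filter (fun T => 2 ≤ (B ∩ T).ncard), T) := by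
  have hxT' : x ∉ T' := fun h => Set.disjoint_left.1 (disjoint_of_skew_union M 𝒯 h𝒯 hskew hT' hT hne) h hxT
  have htr : (B \ {x}) ∩ T' = B ∩ T' := by
    ext w; simp only [Set.mem_inter_iff, Set.mem_sdiff, Set.mem_singleton_iff]
    constructor
    · rintro ⟨⟨h, -⟩, h'⟩; exact ⟨h, h'⟩
    · rintro ⟨h, h'⟩; exact ⟨⟨h, fun hw => hxT' (hw ▸ h')⟩, h'⟩
  -- membership of `y ∈ T'` in a hull depends only on the trace on `T'`
  have key : ∀ B₀ : Set α, y ∈ (B₀ ∪ ⋃ T ∈ 𝒯.filter (fun T => 2 ≤ (B₀ ∩ T).ncard), T) ↔ y ∈ B₀ ∨ 2 ≤ (B₀ ∩ T').ncard := by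
    intro B₀
    rw [mem_skewHull_iff]
    constructor
    · rintro (h | ⟨T'', hT'', hyT'', h2⟩)
      · exact Or.inl h
      · have : T'' = T' := by
          by_contra hne'
          exact Set.disjoint_left.1 (disjoint_of_skew_union M 𝒯 h𝒯 hskew hT'' hT' hne') hyT'' hyT'
        subst this
        exact Or.inr h2
    · rintro (h | h2)
      · exact Or.inl h
      · exact Or.inr ⟨T', hT', hyT', h2⟩
  rw [key, key, htr]
  have hyx : y ≠ x := fun h => hxT' (h ▸ hyT')
  simp only [Set.mem_sdiff, Set.mem_singleton_iff, hyx, not_false_eq_true, and_true]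

/-- **THE SHAPE OF A CIRCUIT THROUGH AN OUTSIDE POINT**: let `z ∉ U` have principal closed trace `F`, and let
`{z} ∪ B` be a circuit with `B ⊆ U`. Then `B` meets a triangle only where `F` does; `B` has `≥ 2` points on every
triangle inside `F`; and on a triangle `T` with `F ∩ T = {a}`, either `B ∩ T = {a}` or `B ∩ T` is the other two
points of `T`. -/
theorem shape_of_isCircuit_of_principal (M : Matroid α) [M.Finite] (𝒯 : Finset (Set α))
    (h𝒯 : ∀ C ∈ 𝒯, M.IsCircuit C ∧ C.ncard = 3) (hskew : M.eRk (⋃ C ∈ 𝒯, C) = 2 * 𝒯.card)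
    {z : α} (hzU : z ∉ ⋃ C ∈ 𝒯, C) {F : Set α} (hFU : F ⊆ ⋃ C ∈ 𝒯, C) (hzF : z ∈ M.closure F)
    (hFmin : ∀ A ⊆ ⋃ C ∈ 𝒯, C, (∀ T ∈ 𝒯, (A ∩ T).ncard ≤ 1 ∨ T ⊆ A) → z ∈ M.closure A → F ⊆ A)
    {B : Set α} (hB : B ⊆ ⋃ C ∈ 𝒯, C) (hC : M.IsCircuit (insert z B)) {T : Set α} (hT : T ∈ 𝒯) :
    ((B ∩ T).Nonempty → (F ∩ T).Nonempty) ∧ (T ⊆ F → 2 ≤ (B ∩ T).ncard) ∧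
      (∀ a, F ∩ T = {a} → B ∩ T = {a} ∨ ((B ∩ T).ncard = 2 ∧ a ∉ B)) := by
  have hTfin : T.Finite := M.ground_finite.subset (h𝒯 T hT).1.subset_ground
  have hzB : z ∉ B := fun h => hzU (hB h)
  have hzcl : z ∈ M.closure B := by
    have hdep : M.Dep (insert z B) := hC.dep
    have hI : M.Indep B := hC.ssubset_indep (Set.ssubset_insert hzB)
    exact (hI.mem_closure_iff_of_notMem hzB).2 hdep
  have hFh : F ⊆ (B ∪ ⋃ T ∈ 𝒯.filter (fun T => 2 ≤ (B ∩ T).ncard), T) :=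
    (mem_closure_iff_principal_subset_skewHull M 𝒯 h𝒯 hskew hzF hFmin hB).1 hzcl
  -- removing a point `x ∈ B ∩ T` loses the hull of `F`
  have hrem : ∀ x ∈ B ∩ T, ¬ F ⊆ (B \ {x} ∪ ⋃ T ∈ 𝒯.filter (fun T => 2 ≤ (B \ {x} ∩ T).ncard), T) := by
    intro x hx hFx
    have hss : B \ {x} ⊂ B := Set.sdiff_singleton_ssubset.2 hx.1
    have hncl := notMem_closure_of_ssubset_of_isCircuit M hC hzB hss
    exact hncl ((mem_closure_iff_principal_subset_skewHull M 𝒯 h𝒯 hskew hzF hFmin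
      (Set.sdiff_subset.trans hB)).2 hFx)
  -- a point `y ∈ F` off `T` survives the removal of any `x ∈ T`
  have hsurv : ∀ x ∈ B ∩ T, ∀ y ∈ F, y ∉ T → y ∈ (B \ {x} ∪ ⋃ T ∈ 𝒯.filter (fun T => 2 ≤ (B \ {x} ∩ T).ncard), T) := by
    intro x hx y hyF hyT
    obtain ⟨T', hT', hyT'⟩ := Set.mem_iUnion₂.1 (hFU hyF)
    have hne : T' ≠ T := fun h => hyT (h ▸ hyT')
    exact (mem_skewHull_diff_iff M 𝒯 h𝒯 hskew hT hT' hne hx.2 hyT').2 (hFh hyF)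
  -- the trace of the hull on `T`
  have hmemT : ∀ y ∈ T, y ∈ (B ∪ ⋃ T ∈ 𝒯.filter (fun T => 2 ≤ (B ∩ T).ncard), T) ↔ y ∈ B ∨ 2 ≤ (B ∩ T).ncard := by
    intro y hy
    rw [mem_skewHull_iff]
    constructor
    · rintro (h | ⟨T'', hT'', hyT'', h2⟩)
      · exact Or.inl h
      · have : T'' = T := by
          by_contra hne'
          exact Set.disjoint_left.1 (disjoint_of_skew_union M 𝒯 h𝒯 hskew hT'' hT hne') hyT'' hy
        subst this
        exact Or.inr h2
    · rintro (h | h2)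
      · exact Or.inl h
      · exact Or.inr ⟨T, hT, hy, h2⟩
  refine ⟨?_, ?_, ?_⟩
  · -- (a) `B ∩ T ≠ ∅ → F ∩ T ≠ ∅`
    rintro ⟨x, hx⟩
    by_contra hFT
    rw [Set.not_nonempty_iff_eq_empty] at hFT
    apply hrem x hx
    intro y hyF
    have hyT : y ∉ T := fun h => by
      have : y ∈ F ∩ T := ⟨hyF, h⟩
      rw [hFT] at this
      exact this
    exact hsurv x hx y hyF hyT
  · -- (b) `T ⊆ F → 2 ≤ |B ∩ T|`
    intro hTF
    by_contra hlt
    push Not at hlt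
    have hTB : T ⊆ B := by
      intro y hy
      have := (hmemT y hy).1 (hFh (hTF hy))
      rcases this with h | h
      · exact h
      · omega
    have : (B ∩ T).ncard = 3 := by rw [Set.inter_eq_right.2 hTB, (h𝒯 T hT).2]
    omega
  · -- (c) `F ∩ T = {a}`
    intro a hFa
    have haF : a ∈ F := (Set.ext_iff.1 hFa a |>.2 rfl).1
    have haT : a ∈ T := (Set.ext_iff.1 hFa a |>.2 rfl).2
    have hah := (hmemT a haT).1 (hFh haF)
    by_cases haB : a ∈ B
    · left
      -- `a ∈ B`: any second point `x` of `B ∩ T` could be removed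
      by_contra hne
      have h1 : {a} ⊆ B ∩ T := Set.singleton_subset_iff.2 ⟨haB, haT⟩
      have hss : {a} ⊂ B ∩ T := ⟨h1, fun h => hne (Set.Subset.antisymm h h1)⟩
      obtain ⟨x, hx, hxa⟩ := Set.exists_of_ssubset hss
      rw [Set.mem_singleton_iff] at hxa
      apply hrem x hx
      intro y hyF
      by_cases hyT : y ∈ T
      · have hya : y = a := by
          have : y ∈ F ∩ T := ⟨hyF, hyT⟩
          rw [hFa] at this
          exact this
        rw [hya]
        exact subset_skewHull 𝒯 _ ⟨haB, fun h => hxa (Set.mem_singleton_iff.1 h).symm⟩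
      · exact hsurv x hx y hyF hyT
    · right
      rcases hah with h | h2
      · exact absurd h haB
      · refine ⟨?_, haB⟩
        have hle : (B ∩ T).ncard ≤ 3 := by
          have := Set.ncard_le_ncard (Set.inter_subset_right : B ∩ T ⊆ T) hTfin
          rwa [(h𝒯 T hT).2] at this
        have hne3 : (B ∩ T).ncard ≠ 3 := by
          intro h3
          have hTB : B ∩ T = T := Set.eq_of_subset_of_ncard_le Set.inter_subset_right (by rw [h3, (h𝒯 T hT).2]) hTfin
          exact haB ((Set.ext_iff.1 hTB a |>.2 haT).1)
        omega

end S1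

end PercRepro
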